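import Mathlib
import Summits.AtomisticToContinuum.Crystallization.Theses.PhononSlackCertificates
import Summits.AtomisticToContinuum.Crystallization.Theorems.PhononSlackCertificatesNearFarGlueRHoles
import Summits.AtomisticToContinuum.Crystallization.Theorems.PhononSlackCertificatesNearFarGlueRAssembly
import Literature.MathematicalPhysics.StatisticalMechanics.LennardJonesClusters

/-!
# Crux `PhononSlackCertificates.NearFarGlueR` (stmt-AtomisticToContinuum-14970), line `Sketch`:
the BOX form of the mirror principle (registered sub-goal `stub_boxMirror`, skeleton v6)

Particles of a finite injective configuration `x` of `ℝ³` lying in an axis-aligned box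
`∏_a [ℓ_a, u_a]` with margins `9/20` pay on all six faces at once:
`N·e* ≤ 𝓔_LJ(x) + ½·Σ_i Σ_a [V(2(x_i^a − ℓ_a)) + V(2(u_a − x_i^a))]`, `e* = ⨅_Q e(Q)`.

Proof: ITERATED DOUBLING.  For weights `θ, θ' : Fin 3 → ℝ` let `BoxW[θ, θ']` (shorthand of this
docstring only; the statements below spell it out) be the weighted inequality
`N·e* ≤ 𝓔(x) + ½·Σ_a (θ_a·A_a + θ'_a·B_a)` for ALL admissible data, where
`A_a = Σ_i V(2(x_i^a − ℓ_a)) ≤ 0`, `B_a = Σ_i V(2(u_a − x_i^a)) ≤ 0` are the lower / upper face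
sums.
* `BoxW[0, 0]` is periodisation (`card_mul_eStar_le`).
* Doubling across the LOWER face of axis `a` (`box_double`): glue to `x` its mirror image
  `σ x` in the plane `p_a = ℓ_a`; the `2N`-particle configuration `x ⊕ σ x` is admissible for the
  box with `ℓ_a` replaced by `2ℓ_a − u_a`, its energy is `≤ 2𝓔(x) + A_a` (cross distances `≥ 9/10`,
  each particle faces its own image at distance `2(x_i^a − ℓ_a)`), its face sums are twice those
  of `x` off the axis `a`, and on the axis `a` both faces see `B_a` plus non-positive far terms;
  whence `BoxW[θ, θ'] → BoxW[θ[a ↦ 1], θ'[a ↦ (θ_a + θ'_a)/2]]`.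
* `BoxW` is antitone in the weights (`box_antitone`), so two doublings per axis take the constant
  weight `c` to `(1 + c)/2` (`box_round`, `box_const`: weight `1 − 2^{−m}` after `m` rounds), and
  `m → ∞` gives the claim (`stub_boxMirror`).
All `[folklore]`.
-/

noncomputable section

namespace Summit.AtomisticToContinuum.Crystallization.Theorems.PhononSlackCertificatesNearFarGlueR

open Literature.MathematicalPhysics.StatisticalMechanics
open Literature.Geometry.DiscreteGeometry
open Summit.AtomisticToContinuum.Crystallization.Theses.PhononSlackCertificates
open Summit.AtomisticToContinuum.Crystallization.Theorems.ChargedEnergyGapNegative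
  (eStar card_mul_eStar_le)
open scoped BigOperators RealInnerProductSpace
open Filter Topology

/-! ## §1 The weighted box inequality and the doubling step -/

/-- **Doubling across the lower face of axis `a`.**  If the weighted box inequality holds with
weights `(θ, θ')` (`θ_a, θ'_a ≥ 0`), it holds with `θ_a := 1`, `θ'_a := (θ_a + θ'_a)/2` (other
weights unchanged): apply it to the `2N` particles `x ⊕ σ x`, `σ` the mirror in the plane
`p_a = ℓ_a`, in the box with lower face `2ℓ_a − u_a`. [folklore] -/
theorem box_double (θ θ' : Fin 3 → ℝ) (a : Fin 3) (ha : 0 ≤ θ a) (ha' : 0 ≤ θ' a)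
    (H : ∀ (N : ℕ) (x : Fin N → EuclideanSpace ℝ (Fin 3)), Function.Injective x →
      ∀ (ℓ u : Fin 3 → ℝ),
        (∀ (i : Fin N) (b : Fin 3), ℓ b + 9 / 20 ≤ x i b ∧ x i b + 9 / 20 ≤ u b) →
        (N : ℝ) * (⨅ Q : PeriodicConfiguration 3, Q.energyPerParticle lennardJones) ≤
          interactionEnergy lennardJones x +
            (1 / 2 : ℝ) * ∑ b : Fin 3,
              (θ b * ∑ i : Fin N, lennardJones (2 * (x i b - ℓ b)) +
                θ' b * ∑ i : Fin N, lennardJones (2 * (u b - x i b)))) :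
    ∀ (N : ℕ) (x : Fin N → EuclideanSpace ℝ (Fin 3)), Function.Injective x →
      ∀ (ℓ u : Fin 3 → ℝ),
        (∀ (i : Fin N) (b : Fin 3), ℓ b + 9 / 20 ≤ x i b ∧ x i b + 9 / 20 ≤ u b) →
        (N : ℝ) * (⨅ Q : PeriodicConfiguration 3, Q.energyPerParticle lennardJones) ≤
          interactionEnergy lennardJones x +
            (1 / 2 : ℝ) * ∑ b : Fin 3,
              (Function.update θ a 1 b * ∑ i : Fin N, lennardJones (2 * (x i b - ℓ b)) +
                Function.update θ' a ((θ a + θ' a) / 2) b *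
                  ∑ i : Fin N, lennardJones (2 * (u b - x i b))) := by
  intro N x hx ℓ u hbox
  -- the unit normal `e_a` and the mirror `σ` in the lower face `p a = ℓ a`
  obtain ⟨n, hn_def⟩ : ∃ n : EuclideanSpace ℝ (Fin 3), n = EuclideanSpace.single a (1 : ℝ) :=
    ⟨_, rfl⟩
  have hn : ‖n‖ = 1 := by rw [hn_def, PiLp.norm_single, norm_one]
  have hin : ∀ p : EuclideanSpace ℝ (Fin 3), ⟪p, n⟫ = p a := fun p => by
    rw [hn_def, EuclideanSpace.inner_single_right]; simp
  obtain ⟨σ, hσ⟩ : ∃ σ : EuclideanSpace ℝ (Fin 3) → EuclideanSpace ℝ (Fin 3),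
      ∀ p, σ p = p - (2 * (⟪p, n⟫ - ℓ a)) • n := ⟨_, fun p => rfl⟩
  have hσa : ∀ p : EuclideanSpace ℝ (Fin 3), σ p a = 2 * ℓ a - p a := fun p => by
    rw [hσ, PiLp.sub_apply, PiLp.smul_apply, hn_def, PiLp.single_apply, if_pos rfl, ← hn_def, hin,
      smul_eq_mul]
    ring
  have hσne : ∀ (p : EuclideanSpace ℝ (Fin 3)) (b : Fin 3), b ≠ a → σ p b = p b :=
      fun p b hb => by
    rw [hσ, PiLp.sub_apply, PiLp.smul_apply, hn_def, PiLp.single_apply, if_neg hb, smul_zero,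
      sub_zero]
  have hσdist : ∀ p q, dist (σ p) (σ q) = dist p q := fun p q => by
    rw [hσ, hσ]; exact dist_mirror_mirror hn (ℓ a) p q
  -- signed distances from the plane
  have hlow : ∀ i : Fin N, (9 / 20 : ℝ) ≤ ⟪x i, n⟫ - ℓ a := fun i => by
    rw [hin]; linarith [(hbox i a).1]
  have hcross : ∀ i l : Fin N, (9 / 10 : ℝ) ≤ dist (x i) (σ (x l)) := fun i l => by
    have := add_le_dist_mirror hn (ℓ a) (x i) (x l)
    rw [← hσ] at this
    linarith [hlow i, hlow l]
  have hoff : ∀ (l i : Fin N), (σ ∘ x) l ≠ x i := fun l i heq => by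
    have := hcross i l
    rw [Function.comp_apply] at heq
    rw [heq, dist_self] at this
    linarith
  have hy : Function.Injective (Fin.append x (σ ∘ x)) :=
    append_injective hx (injective_comp_of_dist_eq hx σ hσdist) hoff
  -- the new box: lower face of axis `a` moved to `2 ℓ a - u a`
  obtain ⟨ℓ', hℓ'⟩ : ∃ ℓ' : Fin 3 → ℝ, ℓ' = Function.update ℓ a (2 * ℓ a - u a) := ⟨_, rfl⟩
  have hℓ'a : ℓ' a = 2 * ℓ a - u a := by rw [hℓ', Function.update_self]
  have hℓ'ne : ∀ b, b ≠ a → ℓ' b = ℓ b := fun b hb => by rw [hℓ', Function.update_of_ne hb]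
  have hbox' : ∀ (k : Fin (N + N)) (b : Fin 3),
      ℓ' b + 9 / 20 ≤ Fin.append x (σ ∘ x) k b ∧ Fin.append x (σ ∘ x) k b + 9 / 20 ≤ u b := by
    intro k b
    induction k using Fin.addCases with
    | left i =>
      rw [Fin.append_left]
      by_cases hb : b = a
      · rw [hb, hℓ'a]
        constructor <;> linarith [(hbox i a).1, (hbox i a).2]
      · rw [hℓ'ne b hb]; exact hbox i b
    | right i =>
      rw [Fin.append_right, Function.comp_apply]
      by_cases hb : b = a
      · rw [hb, hℓ'a, hσa]
        constructor <;> linarith [(hbox i a).1, (hbox i a).2]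
      · rw [hℓ'ne b hb, hσne _ b hb]; exact hbox i b
  -- the weighted inequality for the doubled configuration
  have hH := H (N + N) (Fin.append x (σ ∘ x)) hy ℓ' u hbox'
  push_cast at hH
  -- its energy
  have hE : interactionEnergy lennardJones (Fin.append x (σ ∘ x)) ≤
      2 * interactionEnergy lennardJones x + ∑ i, lennardJones (2 * (x i a - ℓ a)) := by
    rw [interactionEnergy_append lennardJones lennardJones_zero,
      interactionEnergy_comp_of_dist_eq x σ hσdist]
    have hrow : ∀ i : Fin N, ∑ l, lennardJones (dist (x i) ((σ ∘ x) l)) ≤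
        lennardJones (2 * (x i a - ℓ a)) := fun i => by
      rw [← Finset.add_sum_erase _ _ (Finset.mem_univ i), Function.comp_apply, hσ,
        dist_mirror_self hn (ℓ a) (x i) (by linarith [hlow i]), hin]
      have hrest : ∑ l ∈ Finset.univ.erase i, lennardJones (dist (x i) ((σ ∘ x) l)) ≤ 0 :=
        Finset.sum_nonpos fun l _ => lennardJones_nonpos_of_ge_nine_tenths (hcross i l)
      linarith
    have hsum := Finset.sum_le_sum fun i (_ : i ∈ Finset.univ) => hrow i
    linarith
  -- its face sums, split into the `x` half and the `σ x` half
  have hA : ∀ b, ∑ k : Fin (N + N), lennardJones (2 * (Fin.append x (σ ∘ x) k b - ℓ' b)) =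
      ∑ i, lennardJones (2 * (x i b - ℓ' b)) + ∑ i, lennardJones (2 * (σ (x i) b - ℓ' b)) :=
    fun b => by
    rw [Fin.sum_univ_add]
    simp only [Fin.append_left, Fin.append_right, Function.comp_apply]
  have hB : ∀ b, ∑ k : Fin (N + N), lennardJones (2 * (u b - Fin.append x (σ ∘ x) k b)) =
      ∑ i, lennardJones (2 * (u b - x i b)) + ∑ i, lennardJones (2 * (u b - σ (x i) b)) :=
    fun b => by
    rw [Fin.sum_univ_add]
    simp only [Fin.append_left, Fin.append_right, Function.comp_apply]
  -- comparison of the weighted face sums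
  have hfaces :
      ∑ b, (θ b * ∑ k : Fin (N + N), lennardJones (2 * (Fin.append x (σ ∘ x) k b - ℓ' b)) +
        θ' b * ∑ k : Fin (N + N), lennardJones (2 * (u b - Fin.append x (σ ∘ x) k b))) +
      2 * ∑ i, lennardJones (2 * (x i a - ℓ a)) ≤
      2 * ∑ b, (Function.update θ a 1 b * ∑ i, lennardJones (2 * (x i b - ℓ b)) +
        Function.update θ' a ((θ a + θ' a) / 2) b * ∑ i, lennardJones (2 * (u b - x i b))) := by
    rw [← Finset.add_sum_erase _ _ (Finset.mem_univ a),
      ← Finset.add_sum_erase _ _ (Finset.mem_univ a)]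
    -- off the axis `a` the face sums simply double
    have hrest : ∀ b ∈ Finset.univ.erase a,
        θ b * ∑ k : Fin (N + N), lennardJones (2 * (Fin.append x (σ ∘ x) k b - ℓ' b)) +
          θ' b * ∑ k : Fin (N + N), lennardJones (2 * (u b - Fin.append x (σ ∘ x) k b)) =
        2 * (Function.update θ a 1 b * ∑ i, lennardJones (2 * (x i b - ℓ b)) +
          Function.update θ' a ((θ a + θ' a) / 2) b * ∑ i, lennardJones (2 * (u b - x i b))) := by
      intro b hb
      have hba : b ≠ a := Finset.ne_of_mem_erase hb
      rw [hA, hB]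
      simp only [hσne _ b hba, hℓ'ne b hba, Function.update_of_ne hba]
      ring
    rw [Finset.sum_congr rfl hrest, ← Finset.mul_sum]
    -- on the axis `a`: both faces of the doubled configuration see `B_a` plus far terms
    rw [hA a, hB a]
    simp only [hσa, hℓ'a, Function.update_self]
    have hJ₁ : ∑ i, lennardJones (2 * (x i a - (2 * ℓ a - u a))) ≤ 0 :=
      Finset.sum_nonpos fun i _ =>
        lennardJones_nonpos_of_ge_nine_tenths (by linarith [(hbox i a).1, (hbox i a).2])
    have hJ₂ : ∑ i, lennardJones (2 * (u a - (2 * ℓ a - x i a))) ≤ 0 :=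
      Finset.sum_nonpos fun i _ =>
        lennardJones_nonpos_of_ge_nine_tenths (by linarith [(hbox i a).1, (hbox i a).2])
    have hBB : ∑ i, lennardJones (2 * (2 * ℓ a - x i a - (2 * ℓ a - u a))) =
        ∑ i, lennardJones (2 * (u a - x i a)) :=
      Finset.sum_congr rfl fun i _ => by
        rw [show (2 : ℝ) * (2 * ℓ a - x i a - (2 * ℓ a - u a)) = 2 * (u a - x i a) by ring]
    rw [hBB]
    linarith [mul_nonpos_of_nonneg_of_nonpos ha hJ₁, mul_nonpos_of_nonneg_of_nonpos ha' hJ₂]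
  linarith [hH, hE, hfaces]

/-- **The weighted box inequality is antitone in the weights** (all face sums are `≤ 0`).
[folklore] -/
theorem box_antitone (θ₁ θ₁' θ₂ θ₂' : Fin 3 → ℝ) (h : ∀ b, θ₁ b ≤ θ₂ b)
    (h' : ∀ b, θ₁' b ≤ θ₂' b)
    (H : ∀ (N : ℕ) (x : Fin N → EuclideanSpace ℝ (Fin 3)), Function.Injective x →
      ∀ (ℓ u : Fin 3 → ℝ),
        (∀ (i : Fin N) (b : Fin 3), ℓ b + 9 / 20 ≤ x i b ∧ x i b + 9 / 20 ≤ u b) →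
        (N : ℝ) * (⨅ Q : PeriodicConfiguration 3, Q.energyPerParticle lennardJones) ≤
          interactionEnergy lennardJones x +
            (1 / 2 : ℝ) * ∑ b : Fin 3,
              (θ₂ b * ∑ i : Fin N, lennardJones (2 * (x i b - ℓ b)) +
                θ₂' b * ∑ i : Fin N, lennardJones (2 * (u b - x i b)))) :
    ∀ (N : ℕ) (x : Fin N → EuclideanSpace ℝ (Fin 3)), Function.Injective x →
      ∀ (ℓ u : Fin 3 → ℝ),
        (∀ (i : Fin N) (b : Fin 3), ℓ b + 9 / 20 ≤ x i b ∧ x i b + 9 / 20 ≤ u b) →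
        (N : ℝ) * (⨅ Q : PeriodicConfiguration 3, Q.energyPerParticle lennardJones) ≤
          interactionEnergy lennardJones x +
            (1 / 2 : ℝ) * ∑ b : Fin 3,
              (θ₁ b * ∑ i : Fin N, lennardJones (2 * (x i b - ℓ b)) +
                θ₁' b * ∑ i : Fin N, lennardJones (2 * (u b - x i b))) := by
  intro N x hx ℓ u hbox
  have hH := H N x hx ℓ u hbox
  have hA : ∀ b, ∑ i, lennardJones (2 * (x i b - ℓ b)) ≤ 0 := fun b =>
    Finset.sum_nonpos fun i _ => lennardJones_nonpos_of_ge_nine_tenths (by linarith [(hbox i b).1])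
  have hB : ∀ b, ∑ i, lennardJones (2 * (u b - x i b)) ≤ 0 := fun b =>
    Finset.sum_nonpos fun i _ => lennardJones_nonpos_of_ge_nine_tenths (by linarith [(hbox i b).2])
  have hsum : ∑ b, (θ₂ b * ∑ i, lennardJones (2 * (x i b - ℓ b)) +
        θ₂' b * ∑ i, lennardJones (2 * (u b - x i b))) ≤
      ∑ b, (θ₁ b * ∑ i, lennardJones (2 * (x i b - ℓ b)) +
        θ₁' b * ∑ i, lennardJones (2 * (u b - x i b))) :=
    Finset.sum_le_sum fun b _ => add_le_add (mul_le_mul_of_nonpos_right (h b) (hA b))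
      (mul_le_mul_of_nonpos_right (h' b) (hB b))
  linarith

/-- **One round on axis `a`**: two doublings across the lower face take the weights `(c, c)` of
axis `a` to `(1, (1 + c)/2)`, rounded down to `((1 + c)/2, (1 + c)/2)`. [folklore] -/
theorem box_round (θ θ' : Fin 3 → ℝ) (a : Fin 3) {c : ℝ} (hc0 : 0 ≤ c) (hc1 : c ≤ 1)
    (ha : θ a = c) (ha' : θ' a = c)
    (H : ∀ (N : ℕ) (x : Fin N → EuclideanSpace ℝ (Fin 3)), Function.Injective x →
      ∀ (ℓ u : Fin 3 → ℝ),
        (∀ (i : Fin N) (b : Fin 3), ℓ b + 9 / 20 ≤ x i b ∧ x i b + 9 / 20 ≤ u b) →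
        (N : ℝ) * (⨅ Q : PeriodicConfiguration 3, Q.energyPerParticle lennardJones) ≤
          interactionEnergy lennardJones x +
            (1 / 2 : ℝ) * ∑ b : Fin 3,
              (θ b * ∑ i : Fin N, lennardJones (2 * (x i b - ℓ b)) +
                θ' b * ∑ i : Fin N, lennardJones (2 * (u b - x i b)))) :
    ∀ (N : ℕ) (x : Fin N → EuclideanSpace ℝ (Fin 3)), Function.Injective x →
      ∀ (ℓ u : Fin 3 → ℝ),
        (∀ (i : Fin N) (b : Fin 3), ℓ b + 9 / 20 ≤ x i b ∧ x i b + 9 / 20 ≤ u b) →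
        (N : ℝ) * (⨅ Q : PeriodicConfiguration 3, Q.energyPerParticle lennardJones) ≤
          interactionEnergy lennardJones x +
            (1 / 2 : ℝ) * ∑ b : Fin 3,
              (Function.update θ a ((1 + c) / 2) b * ∑ i : Fin N, lennardJones (2 * (x i b - ℓ b)) +
                Function.update θ' a ((1 + c) / 2) b *
                  ∑ i : Fin N, lennardJones (2 * (u b - x i b))) := by
  have h1 := box_double θ θ' a (by rw [ha]; exact hc0) (by rw [ha']; exact hc0) H
  have h2 := box_double (Function.update θ a 1) (Function.update θ' a ((θ a + θ' a) / 2)) a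
    (by rw [Function.update_self]; norm_num)
    (by rw [Function.update_self, ha, ha']; linarith) h1
  refine box_antitone _ _ _ _ (fun b => ?_) (fun b => ?_) h2
  · rcases eq_or_ne b a with hb | hb
    · rw [hb]; simp only [Function.update_self]; linarith
    · simp only [Function.update_of_ne hb]; exact le_rfl
  · rcases eq_or_ne b a with hb | hb
    · rw [hb]; simp only [Function.update_self, ha, ha']; linarith
    · simp only [Function.update_of_ne hb]; exact le_rfl

/-- **After `m` rounds on each axis all six weights are `1 − 2^{−m}`.** [folklore] -/
theorem box_const (m : ℕ) :
    ∀ (N : ℕ) (x : Fin N → EuclideanSpace ℝ (Fin 3)), Function.Injective x →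
      ∀ (ℓ u : Fin 3 → ℝ),
        (∀ (i : Fin N) (b : Fin 3), ℓ b + 9 / 20 ≤ x i b ∧ x i b + 9 / 20 ≤ u b) →
        (N : ℝ) * (⨅ Q : PeriodicConfiguration 3, Q.energyPerParticle lennardJones) ≤
          interactionEnergy lennardJones x +
            (1 / 2 : ℝ) * ∑ b : Fin 3,
              ((fun _ => 1 - (1 / 2 : ℝ) ^ m) b * ∑ i : Fin N, lennardJones (2 * (x i b - ℓ b)) +
                (fun _ => 1 - (1 / 2 : ℝ) ^ m) b *
                  ∑ i : Fin N, lennardJones (2 * (u b - x i b))) := by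
  induction m with
  | zero =>
    intro N x hx ℓ u hbox
    simp only [pow_zero, sub_self, zero_mul, add_zero, Finset.sum_const_zero, mul_zero]
    exact card_mul_eStar_le hx
  | succ m ih =>
    have hp0 : (0 : ℝ) ≤ (1 / 2) ^ m := by positivity
    have hp1 : (1 / 2 : ℝ) ^ m ≤ 1 := pow_le_one₀ (by norm_num) (by norm_num)
    have hc0 : (0 : ℝ) ≤ 1 - (1 / 2) ^ m := by linarith
    have hc1 : 1 - (1 / 2 : ℝ) ^ m ≤ 1 := by linarith
    have hc' : (1 + (1 - (1 / 2 : ℝ) ^ m)) / 2 = 1 - (1 / 2) ^ (m + 1) := by ring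
    have h0 := box_round _ _ 0 hc0 hc1 rfl rfl ih
    have h1 := box_round _ _ 1 hc0 hc1 (by simp) (by simp) h0
    have h2 := box_round _ _ 2 hc0 hc1 (by simp) (by simp) h1
    rw [hc'] at h2
    refine box_antitone _ _ _ _ (fun b => ?_) (fun b => ?_) h2 <;>
    · fin_cases b <;> simp

/-! ## §2 The registered sub-goal -/

/-- **Registered sub-goal `stub_boxMirror` of the line `Sketch` (skeleton v6): the BOX form of the
mirror principle.**  Particles of a finite injective configuration in an axis-aligned box
`∏_a [ℓ_a, u_a]` with margins `9/20` pay on all six faces at once: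
`N·e* ≤ 𝓔_LJ(x) + ½·Σ_i Σ_a [V(2(x_i^a − ℓ_a)) + V(2(u_a − x_i^a))]` — the limit `m → ∞` of
`box_const`. [folklore] -/
theorem stub_boxMirror :
    ∀ (N : ℕ) (x : Fin N → EuclideanSpace ℝ (Fin 3)), Function.Injective x →
    ∀ (ℓ u : Fin 3 → ℝ),
      (∀ (i : Fin N) (a : Fin 3), ℓ a + 9 / 20 ≤ x i a ∧ x i a + 9 / 20 ≤ u a) →
      (N : ℝ) * (⨅ Q : PeriodicConfiguration 3, Q.energyPerParticle lennardJones) ≤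
        interactionEnergy lennardJones x +
          (1 / 2 : ℝ) * ∑ i : Fin N, ∑ a : Fin 3, (lennardJones (2 * (x i a - ℓ a)) +
            lennardJones (2 * (u a - x i a))) := by
  intro N x hx ℓ u hbox
  set S := ∑ i : Fin N, ∑ a : Fin 3, (lennardJones (2 * (x i a - ℓ a)) +
    lennardJones (2 * (u a - x i a))) with hS
  have hm : ∀ m : ℕ, (N : ℝ) * (⨅ Q : PeriodicConfiguration 3, Q.energyPerParticle lennardJones) ≤
      interactionEnergy lennardJones x + (1 / 2 : ℝ) * ((1 - (1 / 2 : ℝ) ^ m) * S) := by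
    intro m
    have e : (1 - (1 / 2 : ℝ) ^ m) * S =
        ∑ a : Fin 3, ((1 - (1 / 2 : ℝ) ^ m) * ∑ i : Fin N, lennardJones (2 * (x i a - ℓ a)) +
          (1 - (1 / 2 : ℝ) ^ m) * ∑ i : Fin N, lennardJones (2 * (u a - x i a))) := by
      rw [hS, Finset.sum_comm, Finset.mul_sum]
      refine Finset.sum_congr rfl fun a _ => ?_
      rw [Finset.sum_add_distrib, mul_add]
    rw [e]
    exact box_const m N x hx ℓ u hbox
  have hlim : Tendsto (fun m : ℕ => interactionEnergy lennardJones x +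
      (1 / 2 : ℝ) * ((1 - (1 / 2 : ℝ) ^ m) * S)) atTop
      (𝓝 (interactionEnergy lennardJones x + (1 / 2 : ℝ) * ((1 - 0) * S))) :=
    tendsto_const_nhds.add (tendsto_const_nhds.mul
      ((tendsto_const_nhds.sub
        (tendsto_pow_atTop_nhds_zero_of_lt_one (by norm_num) (by norm_num))).mul
          tendsto_const_nhds))
  have h := ge_of_tendsto' hlim hm
  rw [sub_zero, one_mul] at h
  exact h

end Summit.AtomisticToContinuum.Crystallization.Theorems.PhononSlackCertificatesNearFarGlueR

end
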